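import Summits.ResolutionOfSingularities.ResolutionOfSingularities.Theorems.HomologicalConductorNoZenoSeam1PackageNode
import Summits.ResolutionOfSingularities.ResolutionOfSingularities.Theorems.HomologicalConductorNoZenoRouteMCountDrop
import Summits.ResolutionOfSingularities.ResolutionOfSingularities.Theorems.HomologicalConductorNoZenoFiniteCentreBlowup
import Summits.ResolutionOfSingularities.ResolutionOfSingularities.Theorems.HomologicalConductorNoZenoWeightUp
import Summits.ResolutionOfSingularities.ResolutionOfSingularities.Theorems.HomologicalConductorNoZenoChartGermResidueAlgebraic
import Summits.ResolutionOfSingularities.ResolutionOfSingularities.Theorems.HomologicalConductorNoZenoH0LeResidueDegree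
import Summits.ResolutionOfSingularities.ResolutionOfSingularities.Theorems.HomologicalConductorNoZenoExcDegreeOnePoint
import HarnessLib

/-!
# Crux `NoZenoR` (stmt-ResolutionOfSingularities-19943), slot 5 (B1) `stub_L1wCoreF3`: **seam1 + seam2 COMPOSED (Route M)** — the split
# count of the new germ drops for the blow-up of ANY finite set of two-curve nodes

OURS (cell res-hironaka, crux chain W4.4, lead res-L0-w44-lead-1 g9); nothing here is a statement of the manuscript under review (Hironaka
2017); AI-written, weaker than expert review.  SUPPORT-level, counted 0.  Def-free.  FACTS as explicit binders (BRICK RULE).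

`hasSplitExcCurveCountLE_pred_of_finiteCentre`: in the literal `Sig.L1Core` binders (germ `D = T_P`, base ideal `(C)`, chart ring `B`,
new germ `D′ = (nrm B)_𝔮`, singular), for a resolution `π : X → Spec D` all of whose exceptional curves have split weight one and with
`N^s(π) ≤ N`, and the blow-up `ρ : X¹ → X` of a FINITE set `Nc` of closed points each lying on TWO DISTINCT exceptional curves of `π`,
with `(C)·𝒪_{X¹}` principal over the closed point: `N^s(D′) ≤ N − 1`.  (The closer applies it UPSTAIRS: `D = D_f`, `π = π_f`,
`Nc = σ⁻¹(sepNodes π)`.)  Pure composition: `exists_seam1Package_of_blowup` (p575368) → o5's `FiniteCentreBlowup.*` (p571647: the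
resolution `ρ ≫ π`, old/new curves, SUBDIVISION) → stub-3's (W-up) `splitWeight_le_of_sq` (p574275) with (HALG) p575124 →
`hasSplitExcCurveCountLE_pred_routeM` (p572829).

References: J. Lipman, *Rational singularities …*, Publ. Math. IHÉS 36 (1969), §§10–16, §24, §27 [`Lipman1969`].
-/

noncomputable section

-- single-problem summit: the doubled namespace component `ResolutionOfSingularities` is forced
set_option linter.dupNamespace false

open CategoryTheory CategoryTheory.Limits AlgebraicGeometry TopologicalSpace Opposite IsLocalRing
open Literature.AlgebraicGeometry Literature.AlgebraicGeometry.Resolution Literature.AlgebraicGeometry.Motives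
open Summit.ResolutionOfSingularities.ResolutionOfSingularities.Theorems.NoZeno.Birth
open Summit.ResolutionOfSingularities.ResolutionOfSingularities.Theorems.NoZeno.SandwichCluster
open Summit.ResolutionOfSingularities.ResolutionOfSingularities.Theorems.NoZeno.SandwichCluster.Parasite
  (locPrime isLocalRing_locPrime mem_locPrime_of_mem)
open Summit.ResolutionOfSingularities.ResolutionOfSingularities.Theorems.NoZeno.SandwichCluster.Thread
  (toSubring_le_locPrime isLocalization_locPrime essFiniteType_blowupChart)
open Summit.ResolutionOfSingularities.ResolutionOfSingularities.Theorems.NoZeno.SplittingBase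
  (locPrimeSubalgebra le_locPrimeSubalgebra)
open Summit.ResolutionOfSingularities.ResolutionOfSingularities.Theorems.SyzygyFlattening
  (self_le_nrm isIntegrallyClosed_nrm stub_essFiniteType_nrm)

namespace Summit.ResolutionOfSingularities.ResolutionOfSingularities.Theorems.NoZeno.ExcCount

variable {k K : Type} [Field k] [Field K] [Algebra k K]

/-- **seam1 ∘ seam2 (ROUTE M): the split count of the new germ drops after blowing up finitely many two-curve nodes.**  See the module
docstring. [cite: Lipman1969, Theorem (4.1) (p. 204), Corollary (27.3) (p. 277), Section 24 (p. 258)] -/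
theorem hasSplitExcCurveCountLE_pred_of_finiteCentre
    (h273 : Lipman1969_27_3_rat.{0}) (h131d : Lipman1969_13_1_d_rat.{0}) (h131b : Lipman1969_13_1_b_rat.{0})
    (h15a : Lipman1969_15_a.{0}) (h41 : Lipman1969_4_1.{0}) (h12 : Lipman1969_1_2.{0}) (h121 : Lipman1969_12_1_i.{0})
    (T : Subalgebra k K) (P : Ideal ↥T) (hP : P.IsPrime)
    [Algebra.EssFiniteType k ↥T] [IsIntegrallyClosed ↥T] [IsFractionRing ↥T K]
    (hdim : ringKrullDim ↥(locPrime T P hP) = 2) (hrat : HasRationalSingularity ↥(locPrime T P hP))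
    (C : Set K) (hCT : C ⊆ (T : Set K))
    (hrad : (Ideal.span {d : ↥(locPrime T P hP) | (d : K) ∈ C}).radical =
      @maximalIdeal ↥(locPrime T P hP) _ (isLocalRing_locPrime T P hP))
    (x : K) (hxC : x ∈ C) (hx0 : x ≠ 0)
    (B : Subalgebra k K) (hB : B = Algebra.adjoin k ((locPrime T P hP : Set K) ∪ {y : K | ∃ c ∈ C, y = c * x⁻¹}))
    (𝔮 : Ideal ↥(nrm B)) (h𝔮 : 𝔮.IsPrime) (D' : Subring K) (hD' : IsLocalRing ↥D')
    (hEq : locPrime (nrm B) 𝔮 h𝔮 = D') (hDD' : (locPrime T P hP : Set K) ⊆ D')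
    (hdim' : ringKrullDim ↥D' = 2) (hnorm' : IsIntegrallyClosed ↥D')
    (hratD' : HasRationalSingularity ↥D') (hsing : ¬ IsRegularLocalRing ↥D')
    -- the resolution with split weights one and `N^s ≤ N`
    {X : Scheme.{0}} (π : X ⟶ Spec (.of ↥(locPrime T P hP))) (hπ : IsResolution π)
    {N : ℕ} (hN : splitExcCount π ≤ N) (hw1 : ∀ η ∈ excCurvePoints π, splitWeight π η = 1)
    -- the finite centre of two-curve nodes and its blow-up
    {Nc : Set X} (hNfin : Nc.Finite) (hNcl : ∀ z ∈ Nc, IsClosed ({z} : Set X))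
    (hNdim : ∀ z ∈ Nc, ringKrullDim (X.presheaf.stalk z) = 2)
    (hsplit : ∀ z ∈ Nc, ∃ a b : X, a ∈ excCurvePoints π ∧ b ∈ excCurvePoints π ∧ a ≠ b ∧ a ⤳ z ∧ b ⤳ z)
    {X1 : Scheme.{0}} (ρ : X1 ⟶ X)
    (hρ : IsBlowup ρ (Scheme.IdealSheafData.vanishingIdeal ⟨Nc,
      FiniteCentreBlowup.isClosed_of_finite_of_isClosed_singleton hNfin hNcl⟩))
    (hprin : ∀ x₁ : X1, IsLocalHom (toStalk (ρ ≫ π) x₁) →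
      ((Ideal.span {d : ↥(locPrime T P hP) | (d : K) ∈ C}).map (toStalk (ρ ≫ π) x₁)).IsPrincipal) :
    @HasSplitExcCurveCountLE ↥D' _ hD' (N - 1) := by
  -- instances on the germ `S := T_P`
  haveI : IsNoetherianRing ↥T := Algebra.EssFiniteType.isNoetherianRing k ↥T
  haveI := isLocalRing_locPrime T P hP
  haveI : IsNoetherianRing ↥(locPrime T P hP) :=
    inferInstanceAs (IsNoetherianRing ↥(locPrimeSubalgebra T P hP))
  haveI : IsIntegrallyClosed ↥(locPrime T P hP) :=
    inferInstanceAs (IsIntegrallyClosed ↥(locPrimeSubalgebra T P hP))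
  haveI := hD'
  haveI := hnorm'
  haveI : IsProper π := hπ.isProper
  haveI : IsIntegral X := hπ.isIntegral_source
  haveI : IsLocallyNoetherian X := LocallyOfFiniteType.isLocallyNoetherian π
  have hfin : (excCurvePoints π).Finite := excCurvePoints_finite_of_isResolution hdim hπ
  set hNc := FiniteCentreBlowup.isClosed_of_finite_of_isClosed_singleton hNfin hNcl with hNc_def
  -- every centre point lies strictly below an exceptional curve, over the closed point, with finite residue degree
  have hNexc : ∀ z ∈ Nc, ∃ η ∈ excCurvePoints π, η ⤳ z ∧ z ≠ η := by
    intro z hz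
    obtain ⟨a, -, ha, -, -, haz, -⟩ := hsplit z hz
    refine ⟨a, ha, haz, fun h => ?_⟩
    have h0 := Scheme.height_of_isClosed (hNcl z hz)
    rw [h, ha.2] at h0
    exact one_ne_zero h0
  have hNπ : ∀ z ∈ Nc, π.base z = closedPoint _ := by
    intro z hz
    obtain ⟨a, ha, haz, -⟩ := hNexc z hz
    exact base_eq_closedPoint_of_specializes π ha.1 haz
  have hNdeg : ∀ z ∈ Nc, π.residueDegree z ≠ 0 := by
    intro z hz
    obtain ⟨a, ha, haz, hne⟩ := hNexc z hz
    rw [← residueDegree_ι_comp_ofPointPt π haz]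
    exact residueDegree_ofPoint_ne_zero π ha _ (by rw [ClosedSubvariety.ofPoint_ι_ofPointPt]; exact hne)
  -- the blow-up `ρ ≫ π` is a resolution; `X¹` integral
  haveI : IsIntegral X1 := FiniteCentreBlowup.isIntegral π ρ hNc hNcl hNexc hρ
  have hψ1 : IsResolution (ρ ≫ π) := FiniteCentreBlowup.isResolution_comp π ρ hNc hNfin hNcl hNexc hπ hρ
  haveI : IsProper (ρ ≫ π) := hψ1.isProper
  haveI : IsProper ρ := FiniteCentreBlowup.isProper π ρ hNc hρ
  haveI : IsLocallyNoetherian X1 := LocallyOfFiniteType.isLocallyNoetherian (ρ ≫ π)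
  -- seam 1 with the node-curve clauses
  obtain ⟨_, C𝔮, W, hW, ψ, hψ, gW, hCsub, hCconn, hCmiss, hgC, hginj, hiso, -, hm2, f, hf, hsq⟩ :=
    exists_seam1Package_of_blowup h12 h121 T P hP hdim hrat C hCT hrad x hxC hx0 B hB 𝔮 h𝔮 D' hD' hEq hDD' hdim' hnorm'
      π ρ hψ1 hprin hπ.isRegular ⟨Nc, hNc⟩ hρ hNfin hNcl hNdim hNπ hNdeg
  haveI := hW
  haveI : IsProper ψ := hψ.isProper
  -- old / new curves of `ρ ≫ π`
  have hcurve := FiniteCentreBlowup.exists_curve_fibre_eq_closure π ρ hNc hNfin hNcl hNexc hdim hπ hρ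
  have hht : ∀ w : X1, (ρ ≫ π).base w = closedPoint _ → Order.height w ≤ 1 :=
    fun w hw => hψ1.height_le_one_of_base_eq_closedPoint hdim hw
  obtain ⟨himg, hρinj⟩ := FiniteCentreBlowup.excCurvePoints_eq_image π ρ hNc hNcl hcurve hρ hht
  have hρmaps : Set.MapsTo ρ.base (excCurvePoints (ρ ≫ π) \ {n | n ∈ excCurvePoints (ρ ≫ π) ∧ ρ.base n ∈ Nc})
      (excCurvePoints π) := by
    intro n hn
    rw [himg]
    exact ⟨n, hn, rfl⟩
  -- SUBDIVISION: every new curve has two distinct old neighbours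
  have hG : (incidenceGraph π).IsAcyclic := incidenceGraph_isAcyclic π hdim hrat hπ h131b h131d
  have hsub := FiniteCentreBlowup.subdivision_finiteCentre π ρ hNc hdim hπ hρ hNfin hNcl hG hsplit
  have hnode : ∀ n ∈ {n | n ∈ excCurvePoints (ρ ≫ π) ∧ ρ.base n ∈ Nc}, ∃ a b : X1,
      a ∈ excCurvePoints (ρ ≫ π) \ {n | n ∈ excCurvePoints (ρ ≫ π) ∧ ρ.base n ∈ Nc} ∧
      b ∈ excCurvePoints (ρ ≫ π) \ {n | n ∈ excCurvePoints (ρ ≫ π) ∧ ρ.base n ∈ Nc} ∧ a ≠ b ∧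
      (incidenceGraph (ρ ≫ π)).Adj n a ∧ (incidenceGraph (ρ ≫ π)).Adj n b := by
    intro n hn
    obtain ⟨a, b, ha, hb, hab, hna, hnb, -⟩ := hsub n hn
    exact ⟨a, b, ha, hb, hab, hna, hnb⟩
  -- instances on the new germ `D′`
  have hTB : (locPrimeSubalgebra T P hP : Subalgebra k K) ≤ B := fun y hy => by
    rw [hB]; exact Algebra.subset_adjoin (Or.inl hy)
  haveI : Algebra.EssFiniteType k ↥B := essFiniteType_blowupChart T P hP C hCT x B hB
  haveI : IsFractionRing ↥B K := isFractionRing_subalgebra_of_le _ _ hTB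
  haveI : Algebra.EssFiniteType k ↥(nrm B) := stub_essFiniteType_nrm k K B inferInstance inferInstance
  haveI : IsNoetherianRing ↥(nrm B) := Algebra.EssFiniteType.isNoetherianRing k _
  letI : Algebra ↥(nrm B) ↥(locPrime (nrm B) 𝔮 h𝔮) := (Subring.inclusion (toSubring_le_locPrime (nrm B) 𝔮 h𝔮)).toAlgebra
  haveI := isLocalization_locPrime (nrm B) 𝔮 h𝔮
  haveI : IsNoetherianRing ↥D' := by
    rw [← hEq]; exact IsLocalization.isNoetherianRing 𝔮.primeCompl _ inferInstance
  haveI : IsLocallyNoetherian W := LocallyOfFiniteType.isLocallyNoetherian ψ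
  -- (W-up): weights do not grow
  have halg := isAlgebraic_residueFieldMap_chartGerm T P hP hdim C hCT x B hB 𝔮 h𝔮 D' hD' hEq hdim' f hf
  have hw : ∀ y ∈ excCurvePoints ψ, gW.base y ∉ {n | n ∈ excCurvePoints (ρ ≫ π) ∧ ρ.base n ∈ Nc} →
      splitWeight ψ y ≤ splitWeight π (ρ.base (gW.base y)) := by
    intro y hy hnew
    have hold : ρ.base (gW.base y) ∈ excCurvePoints π := hρmaps ⟨hCsub (hgC y hy), hnew⟩
    exact splitWeight_le_of_sq ρ ψ gW f hdim hπ hψ1 hsq halg hy.1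
      (ConcreteCategory.bijective_of_isIso (gW.stalkMap y)) hold (hw1 _ hold)
  -- (m2) inputs for the new curves
  have hfk : ∀ y ∈ excCurvePoints ψ, gW.base y ∈ {n | n ∈ excCurvePoints (ρ ≫ π) ∧ ρ.base n ∈ Nc} →
      h0 ψ (primeDivisorIdeal y ^ 2) = 3 * h0 ψ (primeDivisorIdeal y) := fun y hy hnew =>
    (hm2 y hy (ρ.base (gW.base y)) hnew.2
      (FiniteCentreBlowup.preimage_singleton_eq_closure π ρ hcurve hnew.1 hnew.2).symm).1
  have hreg : ∀ y ∈ excCurvePoints ψ, gW.base y ∈ {n | n ∈ excCurvePoints (ρ ≫ π) ∧ ρ.base n ∈ Nc} →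
      ∀ t : W, y ⤳ t → ¬ stalkIdeal (primeDivisorIdeal y) t ≤ (maximalIdeal (W.presheaf.stalk t)) ^ 2 :=
    fun y hy hnew => (hm2 y hy (ρ.base (gW.base y)) hnew.2
      (FiniteCentreBlowup.preimage_singleton_eq_closure π ρ hcurve hnew.1 hnew.2).symm).2
  -- seam 2
  exact hasSplitExcCurveCountLE_pred_routeM h273 h131d h131b h15a h41 hdim hrat hfin hN ρ hψ1
    {n | n ∈ excCurvePoints (ρ ≫ π) ∧ ρ.base n ∈ Nc} hρmaps hρinj hnode C𝔮 hCsub (hCconn hsing) hCmiss hdim' hratD'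
    hψ gW hgC hginj hw hfk hreg

end Summit.ResolutionOfSingularities.ResolutionOfSingularities.Theorems.NoZeno.ExcCount

end
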